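import Literature.MathematicalPhysics.PowerSystems.SMIBGlobalSynchronization
import Summits.Ventures.GridStability.Models.InverterInstances

/-!
# GridStability/Models/GFMSMIBGlobalConvergence — «G3.a-GFM-SMIB-GLOBAL»: every motion of the droop GFM instance of record converges to an equilibrium (Tricomi / Andronov–Vitt–Khaikin damping criterion; certificate-free, ALL initial states)

Cell `gridfusion` (LADDER-GRIDFUSION rung G3.a; filed by the G3.a owner gridfusion-model-3 (g6) on lit-1 (g7)'s
Literature theorem `SMIB.tendsto_equilibrium_of_damping` (`Literature/MathematicalPhysics/PowerSystems/
SMIBGlobalSynchronization.lean`) and lit-1's cross-check file of 09:05:09Z, §1 verbatim; §2 = the reading on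
the CONVERTER model's own solutions (model-3's bridge `ReducedParams.isSolution_toSMIB`, p460249).

For the droop grid-forming converter instance of record «GFM-SMIB-QoriaV4» (`gfmSmibQoriaV4`:
`M = 1/(k_i ω_c) = 113/3550`, `D = 1/k_i = 3729/3550`, `P_m = p*′ = 8290560/16581121`, `P_e^max = 4`,
`δs = arcsin(2072640/16581121)`, `cos δs = 16451071/16581121`) the damping inequality of
`Literature.MathematicalPhysics.PowerSystems.SMIB.tendsto_equilibrium_of_damping` holds with a wide margin:
`2 M P_e^max (1 − cos δs) = 904/3550 · 130050/16581121 ≈ 0.0020 < D² = (3729/3550)² ≈ 1.1034`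
(dimensionless `α = D/√(M P_e^max) ≈ 2.94` against the certificate threshold `2 sin(θ₁/2) ≈ 0.125`).
HENCE (CERTIFIED, model `M` = reduced droop GFM converter vs infinite bus ≡ classical damped SMIB,
MV-6D + MV-P + MV-Ω; class `C` = ALL initial states): every forward solution of the equivalent swing
equation converges to an equilibrium `(δ*, 0)` with `4 sin δ* = p*′` — no sustained asynchronous
(pole-slipping) regime exists for this model from any initial state. NOT CLAIMED: which equilibrium
(s.e.p. vs saddle) is reached; nothing about a converter or a grid.
[cite: AndronovVittKhaikin1966, Ch. VII §3; Qoria2020, §V.4]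
-/

noncomputable section

open Real Set Filter Topology

namespace Summit.Ventures.GridStability.Models.InverterDroop

/-- The damping inequality `2 M P_e^max (1 − cos δs) < D²` for «GFM-SMIB-QoriaV4» (exact rationals). -/
theorem gfmSmibQoriaV4_damping :
    2 * gfmSmibQoriaV4.toSMIB.M * gfmSmibQoriaV4.toSMIB.Pmax * (1 - Real.cos gfmSmibQoriaV4_δs)
      < gfmSmibQoriaV4.toSMIB.D ^ 2 := by
  rw [cos_gfmSmibQoriaV4_δs]
  norm_num [ReducedParams.toSMIB, gfmSmibQoriaV4]

/-- **«G3.a-GFM-SMIB-GLOBAL»**: every forward solution of the swing equation of `gfmSmibQoriaV4.toSMIB`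
(`δ̇ = Ω`, `M Ω̇ = P_m − P_e^max sin δ − D Ω`) converges to an equilibrium `(δ*, 0)`,
`P_e^max sin δ* = P_m`. [cite: AndronovVittKhaikin1966, Ch. VII §3, case `α > α₀`] -/
theorem gfmSmibQoriaV4_tendsto_equilibrium {X : ℝ → ℝ × ℝ}
    (hX : ∀ S : ℝ, ∀ t ∈ Icc 0 S,
      HasDerivWithinAt X (gfmSmibQoriaV4.toSMIB.vectorField (X t)) (Icc 0 S) t) :
    ∃ θe : ℝ, gfmSmibQoriaV4.toSMIB.IsEquilibriumAngle θe ∧ Tendsto X atTop (𝓝 (θe, 0)) := by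
  have hM : 0 < gfmSmibQoriaV4.toSMIB.M := by norm_num [ReducedParams.toSMIB, gfmSmibQoriaV4]
  have hD : 0 < gfmSmibQoriaV4.toSMIB.D := by norm_num [ReducedParams.toSMIB, gfmSmibQoriaV4]
  have hP : 0 < gfmSmibQoriaV4.toSMIB.Pmax := by norm_num [ReducedParams.toSMIB, gfmSmibQoriaV4]
  have heq : gfmSmibQoriaV4.toSMIB.IsEquilibriumAngle gfmSmibQoriaV4_δs := by
    unfold Literature.MathematicalPhysics.PowerSystems.SMIB.IsEquilibriumAngle
    rw [sin_gfmSmibQoriaV4_δs]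
    norm_num [ReducedParams.toSMIB, gfmSmibQoriaV4]
  have hδs0 : 0 < gfmSmibQoriaV4_δs := by
    unfold gfmSmibQoriaV4_δs
    exact Real.arcsin_pos.2 (by norm_num)
  have hδs1 : gfmSmibQoriaV4_δs < π / 2 := by
    unfold gfmSmibQoriaV4_δs
    exact Real.arcsin_lt_pi_div_two.2 (by norm_num)
  exact gfmSmibQoriaV4.toSMIB.tendsto_equilibrium_of_damping hM hD hP heq hδs0 hδs1
    gfmSmibQoriaV4_damping hX

/-- The equilibrium angles of the instance: `4 sin δ* = 8290560/16581121`, i.e. `sin δ* = sin δs`. -/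
theorem gfmSmibQoriaV4_isEquilibriumAngle_iff (θ : ℝ) :
    gfmSmibQoriaV4.toSMIB.IsEquilibriumAngle θ ↔ Real.sin θ = 2072640 / 16581121 := by
  unfold Literature.MathematicalPhysics.PowerSystems.SMIB.IsEquilibriumAngle
  simp only [ReducedParams.toSMIB, gfmSmibQoriaV4]
  constructor
  · intro h; linarith
  · intro h; rw [h]; norm_num

/-! ## §2 The sentence on the converter model's own solutions -/

namespace gfmSmibQoriaV4

/-- **«G3.a-GFM-SMIB-GLOBAL» ON THE CONVERTER MODEL**: every (global, classical) solution `(δ, ω)` of the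
reduced droop grid-forming model of record `gfmSmibQoriaV4` (Qoria «Strategy C», `ω_set = ω_e`) converges:
`δ → δ*` with `sin δ* = s* = 2072640/16581121` (an equilibrium angle) and `ω → ω_e` — from ANY initial
state; via the bridge `isSolution_toSMIB` (the speed deviation `Ω = ω_b′(ω − ω_e)` solves the swing
equation of `toSMIB`) and §1. CERTIFIED (kernel, certificate-free); MODELLED: MV-6D + MV-P + MV-Ω; NOT
CLAIMED: which equilibrium is reached; no converter or grid is called stable.
[cite: AndronovVittKhaikin1966, Ch. VII §3] [cite: Qoria2020, §V.4] -/
theorem droop_tendsto_equilibrium {δ ω : ℝ → ℝ} (h : gfmSmibQoriaV4.IsSolution δ ω) :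
    ∃ θe : ℝ, Real.sin θe = 2072640 / 16581121 ∧
      Tendsto δ atTop (𝓝 θe) ∧ Tendsto ω atTop (𝓝 gfmSmibQoriaV4.ωe) := by
  set X : ℝ → ℝ × ℝ := fun t => (δ t, gfmSmibQoriaV4.ωb * (ω t - gfmSmibQoriaV4.ωe)) with hXdef
  have hsol := fun t => gfmSmibQoriaV4.isSolution_toSMIB ωb_ne_zero ki_ne_zero ωc_ne_zero ωset_eq h t
  have hX : ∀ S : ℝ, ∀ t ∈ Icc 0 S,
      HasDerivWithinAt X (gfmSmibQoriaV4.toSMIB.vectorField (X t)) (Icc 0 S) t := by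
    intro S t _
    have h1 := (hsol t).1
    have h2 := (hsol t).2
    have hpair : HasDerivAt X (gfmSmibQoriaV4.ωb * (ω t - gfmSmibQoriaV4.ωe),
        gfmSmibQoriaV4.toSMIB.accel (δ t) (gfmSmibQoriaV4.ωb * (ω t - gfmSmibQoriaV4.ωe))) t :=
      h1.prodMk h2
    exact hpair.hasDerivWithinAt
  obtain ⟨θe, heq, hlim⟩ := gfmSmibQoriaV4_tendsto_equilibrium hX
  refine ⟨θe, (gfmSmibQoriaV4_isEquilibriumAngle_iff θe).1 heq, ?_, ?_⟩
  · simpa [hXdef] using hlim.fst_nhds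
  · have hΩ : Tendsto (fun t => gfmSmibQoriaV4.ωb * (ω t - gfmSmibQoriaV4.ωe)) atTop (𝓝 0) := by
      simpa [hXdef] using hlim.snd_nhds
    have hb := ωb_ne_zero
    have hω' : Tendsto (fun t => gfmSmibQoriaV4.ωb⁻¹ * (gfmSmibQoriaV4.ωb * (ω t - gfmSmibQoriaV4.ωe))
        + gfmSmibQoriaV4.ωe) atTop (𝓝 (gfmSmibQoriaV4.ωb⁻¹ * 0 + gfmSmibQoriaV4.ωe)) :=
      (hΩ.const_mul _).add_const _
    have hfun : (fun t => gfmSmibQoriaV4.ωb⁻¹ * (gfmSmibQoriaV4.ωb * (ω t - gfmSmibQoriaV4.ωe))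
        + gfmSmibQoriaV4.ωe) = ω := by
      funext t; field_simp; ring
    rw [hfun] at hω'
    simpa using hω'

end gfmSmibQoriaV4

end Summit.Ventures.GridStability.Models.InverterDroop
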